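import Mathlib
import Literature.Analysis.PDE.Wave1DExteriorEnergy
import Literature.Analysis.PDE.FarKernelSpanLemmas
import HarnessLib

/-!
# The span of the true kernel towers: regularity, residual, data, channel energies

Analysis/PDE support file (everything proved, no definitions). Let `T_0,…,T_ℓ` be the
`t`-polynomial towers `T_m(t,x) = Σ_i binom(m,i) E_{m−i}(x) tⁱ` of a corrected chain (global `C²`
functions whose `V`-residual vanishes on `{x > ½}`, with data `(E_m, mE_{m−1})` and with
integrable far `V`-energies tending to `0` at `t → ±∞` beyond `x₁`, as delivered by
`FarChannelsTrueKernel.exists_farTrueTowers`). For coefficient sequences `a, b` the element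

  `Q_{a,b} = Σ_{k<ℓ/2+1} (a_k/c_{2k}) T_{2k} + Σ_{k<(ℓ+1)/2} (b_k/((2k+1)c_{2k})) T_{2k+1}`

(`c_j = ∏_{i<ℓ}(j−2i−1)`) is again a global `C²` function with vanishing residual on `{x > ½}`, a
polynomial in `t` of degree `≤ ℓ` (`farTrueSpan_basic`), its Cauchy data are the `tpos, tvel` of
`FarChannelsKernelTransfer`, and its far channel energies (lower Lebesgue integrals) vanish at
`t → ±∞` and are finite (`lincomb2_farEnergy`, `farTrueSpan_energy`). Route PhotonSphereChannels,
`FixedModeChannels`, far side (stmt-FinalStateConjecture-10048): `Q_{a,b}` is the true kernel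
element with exact shadow `(Σ a_k ι^{ℓ−2k}, Σ b_k ι^{ℓ−2k})`. Folklore.
-/

noncomputable section

namespace Literature.Analysis.PDE

open MeasureTheory Set Filter Topology Finset

variable {V : ℝ → ℝ}

/-! ### Far energies of a two-block linear combination -/

/-- **Far channel energies of `Σ_{k∈u₁} α_k B¹_k + Σ_{k∈u₂} β_k B²_k`.** If every block `Bⁱ_k` is a
global `C²` function with integrable far `V`-energy on `{x > ρ+|t|}` tending to `0` at `±∞`, then so
is the combination, in lower-Lebesgue form: its far energies tend to `0` and the initial one on
`(ρ,∞)` is finite. [folklore] -/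
theorem lincomb2_farEnergy (hV0 : ∀ x, 0 ≤ V x) {u₁ u₂ : Finset ℕ}
    {B₁ B₂ : ℕ → ℝ → ℝ → ℝ} (α β : ℕ → ℝ)
    (hB₁ : ∀ k ∈ u₁, ContDiff ℝ 2 (Function.uncurry (B₁ k)))
    (hB₂ : ∀ k ∈ u₂, ContDiff ℝ 2 (Function.uncurry (B₂ k))) {ρ : ℝ}
    (hE₁ : ∀ k ∈ u₁, (∀ t, IntegrableOn (fun z => deriv (fun τ => B₁ k τ z) t ^ 2
        + deriv (B₁ k t) z ^ 2 + V z * B₁ k t z ^ 2) (Ioi (ρ + |t|))) ∧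
      Tendsto (fun t => ∫ z in Ioi (ρ + |t|), (deriv (fun τ => B₁ k τ z) t ^ 2
        + deriv (B₁ k t) z ^ 2 + V z * B₁ k t z ^ 2)) atTop (𝓝 0) ∧
      Tendsto (fun t => ∫ z in Ioi (ρ + |t|), (deriv (fun τ => B₁ k τ z) t ^ 2
        + deriv (B₁ k t) z ^ 2 + V z * B₁ k t z ^ 2)) atBot (𝓝 0))
    (hE₂ : ∀ k ∈ u₂, (∀ t, IntegrableOn (fun z => deriv (fun τ => B₂ k τ z) t ^ 2
        + deriv (B₂ k t) z ^ 2 + V z * B₂ k t z ^ 2) (Ioi (ρ + |t|))) ∧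
      Tendsto (fun t => ∫ z in Ioi (ρ + |t|), (deriv (fun τ => B₂ k τ z) t ^ 2
        + deriv (B₂ k t) z ^ 2 + V z * B₂ k t z ^ 2)) atTop (𝓝 0) ∧
      Tendsto (fun t => ∫ z in Ioi (ρ + |t|), (deriv (fun τ => B₂ k τ z) t ^ 2
        + deriv (B₂ k t) z ^ 2 + V z * B₂ k t z ^ 2)) atBot (𝓝 0))
    {Q : ℝ → ℝ → ℝ}
    (hQ : ∀ t x, Q t x = ∑ k ∈ u₁, α k * B₁ k t x + ∑ k ∈ u₂, β k * B₂ k t x) :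
    Tendsto (fun t => ∫⁻ z in Ioi (ρ + |t|), ENNReal.ofReal (deriv (fun τ => Q τ z) t ^ 2
        + deriv (Q t) z ^ 2 + V z * Q t z ^ 2)) atTop (𝓝 0) ∧
    Tendsto (fun t => ∫⁻ z in Ioi (ρ + |t|), ENNReal.ofReal (deriv (fun τ => Q τ z) t ^ 2
        + deriv (Q t) z ^ 2 + V z * Q t z ^ 2)) atBot (𝓝 0) ∧
    ∫⁻ z in Ioi ρ, ENNReal.ofReal (deriv (fun τ => Q τ z) 0 ^ 2
        + deriv (Q 0) z ^ 2 + V z * Q 0 z ^ 2) < ⊤ := by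
  have hQf : Q = fun t x => ∑ k ∈ u₁, α k * B₁ k t x + ∑ k ∈ u₂, β k * B₂ k t x :=
    funext fun t => funext fun x => hQ t x
  subst hQf
  -- the two blocks
  set L₁ : ℝ → ℝ → ℝ := fun t x => ∑ k ∈ u₁, α k * B₁ k t x with hL₁
  set L₂ : ℝ → ℝ → ℝ := fun t x => ∑ k ∈ u₂, β k * B₂ k t x with hL₂
  have hL₁C : ContDiff ℝ 2 (Function.uncurry L₁) := contDiff_two_lincomb u₁ α hB₁
  have hL₂C : ContDiff ℝ 2 (Function.uncurry L₂) := contDiff_two_lincomb u₂ β hB₂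
  -- energy densities
  set e₁ : ℕ → ℝ → ℝ → ℝ := fun k t z => deriv (fun τ => B₁ k τ z) t ^ 2
    + deriv (B₁ k t) z ^ 2 + V z * B₁ k t z ^ 2 with he₁
  set e₂ : ℕ → ℝ → ℝ → ℝ := fun k t z => deriv (fun τ => B₂ k τ z) t ^ 2
    + deriv (B₂ k t) z ^ 2 + V z * B₂ k t z ^ 2 with he₂
  set G : ℝ → ℝ → ℝ := fun t z => 2 * ((u₁.card : ℝ) * ∑ k ∈ u₁, α k ^ 2 * e₁ k t z)
    + 2 * ((u₂.card : ℝ) * ∑ k ∈ u₂, β k ^ 2 * e₂ k t z) with hG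
  -- pointwise domination `e[L₁ + L₂] ≤ G`
  have hpt : ∀ t z, deriv (fun τ => (fun t x => L₁ t x + L₂ t x) τ z) t ^ 2
      + deriv ((fun t x => L₁ t x + L₂ t x) t) z ^ 2
      + V z * (fun t x => L₁ t x + L₂ t x) t z ^ 2 ≤ G t z := by
    intro t z
    have d1 : DifferentiableAt ℝ (fun τ => L₁ τ z) t :=
      ((contDiff_two_slices'' hL₁C t z).1.differentiable (by norm_num)) t
    have d2 : DifferentiableAt ℝ (fun τ => L₂ τ z) t :=
      ((contDiff_two_slices'' hL₂C t z).1.differentiable (by norm_num)) t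
    have d3 : DifferentiableAt ℝ (L₁ t) z := ((contDiff_two_slices'' hL₁C t z).2.differentiable
      (by norm_num)) z
    have d4 : DifferentiableAt ℝ (L₂ t) z := ((contDiff_two_slices'' hL₂C t z).2.differentiable
      (by norm_num)) z
    have eτ : deriv (fun τ => L₁ τ z + L₂ τ z) t = deriv (fun τ => L₁ τ z) t + deriv (fun τ => L₂ τ z) t :=
      deriv_fun_add d1 d2
    have ez : deriv (fun y => L₁ t y + L₂ t y) z = deriv (L₁ t) z + deriv (L₂ t) z :=
      deriv_fun_add d3 d4
    show deriv (fun τ => L₁ τ z + L₂ τ z) t ^ 2 + deriv (fun y => L₁ t y + L₂ t y) z ^ 2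
      + V z * (L₁ t z + L₂ t z) ^ 2 ≤ G t z
    rw [eτ, ez]
    have b1 := wave1D_energyDensity_lincomb_le u₁ α (W := V) hB₁ t z (hV0 z)
    have b2 := wave1D_energyDensity_lincomb_le u₂ β (W := V) hB₂ t z (hV0 z)
    have hsq : ∀ p q : ℝ, (p + q) ^ 2 ≤ 2 * p ^ 2 + 2 * q ^ 2 := fun p q => by
      linarith only [sq_nonneg (p - q)]
    have hVz := hV0 z
    have h3 : V z * (L₁ t z + L₂ t z) ^ 2 ≤ 2 * (V z * L₁ t z ^ 2) + 2 * (V z * L₂ t z ^ 2) := by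
      have := mul_le_mul_of_nonneg_left (hsq (L₁ t z) (L₂ t z)) hVz
      linarith
    simp only [hG, he₁, he₂, hL₁, hL₂] at b1 b2 ⊢
    linarith [hsq (deriv (fun τ => ∑ k ∈ u₁, α k * B₁ k τ z) t)
      (deriv (fun τ => ∑ k ∈ u₂, β k * B₂ k τ z) t),
      hsq (deriv (fun y => ∑ k ∈ u₁, α k * B₁ k t y) z) (deriv (fun y => ∑ k ∈ u₂, β k * B₂ k t y) z),
      b1, b2, h3]
  -- integrability and the value of `∫ G`
  have hGi : ∀ t, IntegrableOn (G t) (Ioi (ρ + |t|)) := fun t =>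
    ((integrable_finsetSum _ fun k hk => ((hE₁ k hk).1 t).const_mul (α k ^ 2)).const_mul _
      |>.const_mul 2).add
    ((integrable_finsetSum _ fun k hk => ((hE₂ k hk).1 t).const_mul (β k ^ 2)).const_mul _
      |>.const_mul 2)
  have hGval : ∀ t, ∫ z in Ioi (ρ + |t|), G t z
      = 2 * ((u₁.card : ℝ) * ∑ k ∈ u₁, α k ^ 2 * ∫ z in Ioi (ρ + |t|), e₁ k t z)
        + 2 * ((u₂.card : ℝ) * ∑ k ∈ u₂, β k ^ 2 * ∫ z in Ioi (ρ + |t|), e₂ k t z) := by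
    intro t
    have i1 : IntegrableOn (fun z => 2 * ((u₁.card : ℝ) * ∑ k ∈ u₁, α k ^ 2 * e₁ k t z))
        (Ioi (ρ + |t|)) :=
      ((integrable_finsetSum _ fun k hk => ((hE₁ k hk).1 t).const_mul (α k ^ 2)).const_mul _
        |>.const_mul 2)
    have i2 : IntegrableOn (fun z => 2 * ((u₂.card : ℝ) * ∑ k ∈ u₂, β k ^ 2 * e₂ k t z))
        (Ioi (ρ + |t|)) :=
      ((integrable_finsetSum _ fun k hk => ((hE₂ k hk).1 t).const_mul (β k ^ 2)).const_mul _
        |>.const_mul 2)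
    simp only [hG]
    rw [integral_add i1 i2, integral_const_mul, integral_const_mul, integral_const_mul,
      integral_const_mul, integral_finsetSum _ fun k hk => ((hE₁ k hk).1 t).const_mul (α k ^ 2),
      integral_finsetSum _ fun k hk => ((hE₂ k hk).1 t).const_mul (β k ^ 2)]
    simp only [integral_const_mul]
    rfl
  have hGlim : ∀ F : Filter ℝ, (∀ k ∈ u₁, Tendsto (fun t => ∫ z in Ioi (ρ + |t|), e₁ k t z) F (𝓝 0)) →
      (∀ k ∈ u₂, Tendsto (fun t => ∫ z in Ioi (ρ + |t|), e₂ k t z) F (𝓝 0)) →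
      Tendsto (fun t => ENNReal.ofReal (∫ z in Ioi (ρ + |t|), G t z)) F (𝓝 0) := by
    intro F h1 h2
    have hlim : Tendsto (fun t => ∫ z in Ioi (ρ + |t|), G t z) F (𝓝 0) := by
      simp only [hGval]
      have t1 : Tendsto (fun t => 2 * ((u₁.card : ℝ) * ∑ k ∈ u₁, α k ^ 2
          * ∫ z in Ioi (ρ + |t|), e₁ k t z)) F (𝓝 (2 * ((u₁.card : ℝ) * ∑ k ∈ u₁, α k ^ 2 * 0))) :=
        ((tendsto_finsetSum _ fun k hk => (h1 k hk).const_mul (α k ^ 2)).const_mul _).const_mul 2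
      have t2 : Tendsto (fun t => 2 * ((u₂.card : ℝ) * ∑ k ∈ u₂, β k ^ 2
          * ∫ z in Ioi (ρ + |t|), e₂ k t z)) F (𝓝 (2 * ((u₂.card : ℝ) * ∑ k ∈ u₂, β k ^ 2 * 0))) :=
        ((tendsto_finsetSum _ fun k hk => (h2 k hk).const_mul (β k ^ 2)).const_mul _).const_mul 2
      have := t1.add t2
      simpa using this
    have := ENNReal.tendsto_ofReal hlim
    simpa using this
  -- the lintegral bound
  have hnnQ : ∀ t z, 0 ≤ deriv (fun τ => (fun t x => L₁ t x + L₂ t x) τ z) t ^ 2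
      + deriv ((fun t x => L₁ t x + L₂ t x) t) z ^ 2
      + V z * (fun t x => L₁ t x + L₂ t x) t z ^ 2 := fun t z =>
    wave1D_energyDensity_nonneg (ψ := fun t x => L₁ t x + L₂ t x) hV0 t z
  have hGnn : ∀ t z, 0 ≤ G t z := fun t z => (hnnQ t z).trans (hpt t z)
  have hbound : ∀ t, ∫⁻ z in Ioi (ρ + |t|), ENNReal.ofReal (deriv (fun τ =>
        (fun t x => L₁ t x + L₂ t x) τ z) t ^ 2 + deriv ((fun t x => L₁ t x + L₂ t x) t) z ^ 2
        + V z * (fun t x => L₁ t x + L₂ t x) t z ^ 2)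
      ≤ ENNReal.ofReal (∫ z in Ioi (ρ + |t|), G t z) := by
    intro t
    rw [ofReal_integral_eq_lintegral_ofReal (hGi t) (ae_of_all _ fun z => hGnn t z)]
    exact lintegral_mono fun z => ENNReal.ofReal_le_ofReal (hpt t z)
  have key : ∀ F : Filter ℝ, (∀ k ∈ u₁, Tendsto (fun t => ∫ z in Ioi (ρ + |t|), e₁ k t z) F (𝓝 0)) →
      (∀ k ∈ u₂, Tendsto (fun t => ∫ z in Ioi (ρ + |t|), e₂ k t z) F (𝓝 0)) →
      Tendsto (fun t => ∫⁻ z in Ioi (ρ + |t|), ENNReal.ofReal (deriv (fun τ =>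
        (fun t x => L₁ t x + L₂ t x) τ z) t ^ 2 + deriv ((fun t x => L₁ t x + L₂ t x) t) z ^ 2
        + V z * (fun t x => L₁ t x + L₂ t x) t z ^ 2)) F (𝓝 0) := fun F h1 h2 =>
    tendsto_of_tendsto_of_tendsto_of_le_of_le tendsto_const_nhds (hGlim F h1 h2)
      (fun t => bot_le) hbound
  refine ⟨key atTop (fun k hk => (hE₁ k hk).2.1) (fun k hk => (hE₂ k hk).2.1),
    key atBot (fun k hk => (hE₁ k hk).2.2) (fun k hk => (hE₂ k hk).2.2), ?_⟩
  have h0 := hbound 0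
  simp only [abs_zero, add_zero] at h0
  exact h0.trans_lt ENNReal.ofReal_lt_top

/-! ### The span element `Q_{a,b}` -/

variable {ℓ : ℕ} {E : ℕ → ℝ → ℝ} {T : ℕ → ℝ → ℝ → ℝ} {x₁ : ℝ}

/-- **The span element `Q_{a,b}` of the true kernel towers**: regularity, residual, `t`-polynomial
form and Cauchy data. See the module docstring. [folklore] -/
theorem farTrueSpan_basic
    (hT : ∀ m t x, T m t x = ∑ i ∈ range (m + 1), (m.choose i : ℝ) * E (m - i) x * t ^ i)
    (hTC : ∀ m, m ≤ ℓ → ContDiff ℝ 2 (Function.uncurry (T m)))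
    (hTwave : ∀ m, m ≤ ℓ → ∀ t x, 1 / 2 < x →
      iteratedDeriv 2 (fun τ => T m τ x) t - iteratedDeriv 2 (T m t) x + V x * T m t x = 0)
    (hTdata : ∀ m, m ≤ ℓ → ∀ x,
      T m 0 x = E m x ∧ deriv (fun τ => T m τ x) 0 = (m : ℝ) * E (m - 1) x)
    (a b : ℕ → ℝ) {Q : ℝ → ℝ → ℝ}
    (hQ : ∀ t x, Q t x
      = ∑ k ∈ range (ℓ / 2 + 1), a k / (∏ i ∈ range ℓ, (((2 * k : ℕ) : ℝ) - 2 * i - 1)) * T (2 * k) t x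
        + ∑ k ∈ range ((ℓ + 1) / 2), b k / (((2 * k + 1 : ℕ) : ℝ)
            * ∏ i ∈ range ℓ, (((2 * k : ℕ) : ℝ) - 2 * i - 1)) * T (2 * k + 1) t x) :
    ContDiff ℝ 2 (Function.uncurry Q) ∧
    (∀ t x, 1 / 2 < x →
      iteratedDeriv 2 (fun τ => Q τ x) t - iteratedDeriv 2 (Q t) x + V x * Q t x = 0) ∧
    (∃ co : ℕ → ℝ → ℝ, ∀ t x, Q t x = ∑ i ∈ range (ℓ + 1), co i x * t ^ i) ∧
    (∀ y, Q 0 y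
      = ∑ k ∈ range (ℓ / 2 + 1), a k / (∏ i ∈ range ℓ, (((2 * k : ℕ) : ℝ) - 2 * i - 1)) * E (2 * k) y
        + ∑ k ∈ range ((ℓ + 1) / 2), b k / (((2 * k + 1 : ℕ) : ℝ)
            * ∏ i ∈ range ℓ, (((2 * k : ℕ) : ℝ) - 2 * i - 1)) * E (2 * k + 1) y) ∧
    (∀ z, deriv (fun τ => Q τ z) 0
      = ∑ k ∈ range (ℓ / 2 + 1), a k / (∏ i ∈ range ℓ, (((2 * k : ℕ) : ℝ) - 2 * i - 1))
            * ((2 * k : ℕ) : ℝ) * E (2 * k - 1) z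
        + ∑ k ∈ range ((ℓ + 1) / 2), b k / (((2 * k + 1 : ℕ) : ℝ)
            * ∏ i ∈ range ℓ, (((2 * k : ℕ) : ℝ) - 2 * i - 1)) * (((2 * k + 1 : ℕ) : ℝ) * E (2 * k) z)) := by
  -- coefficients
  set α : ℕ → ℝ := fun k => a k / ∏ i ∈ range ℓ, (((2 * k : ℕ) : ℝ) - 2 * i - 1) with hα
  set β : ℕ → ℝ := fun k => b k / ((((2 * k + 1 : ℕ)) : ℝ)
    * ∏ i ∈ range ℓ, (((2 * k : ℕ) : ℝ) - 2 * i - 1)) with hβ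
  have hQ' : ∀ t x, Q t x = ∑ k ∈ range (ℓ / 2 + 1), α k * T (2 * k) t x
      + ∑ k ∈ range ((ℓ + 1) / 2), β k * T (2 * k + 1) t x := fun t x => hQ t x
  have hQf : Q = fun t x => ∑ k ∈ range (ℓ / 2 + 1), α k * T (2 * k) t x
      + ∑ k ∈ range ((ℓ + 1) / 2), β k * T (2 * k + 1) t x := funext fun t => funext fun x => hQ' t x
  have hka : ∀ k, k ∈ range (ℓ / 2 + 1) → 2 * k ≤ ℓ := fun k hk => by
    have := mem_range.1 hk; omega
  have hkb : ∀ k, k ∈ range ((ℓ + 1) / 2) → 2 * k + 1 ≤ ℓ := fun k hk => by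
    have := mem_range.1 hk; omega
  have hB₁ : ∀ k ∈ range (ℓ / 2 + 1), ContDiff ℝ 2 (Function.uncurry (T (2 * k))) :=
    fun k hk => hTC _ (hka k hk)
  have hB₂ : ∀ k ∈ range ((ℓ + 1) / 2), ContDiff ℝ 2 (Function.uncurry (T (2 * k + 1))) :=
    fun k hk => hTC _ (hkb k hk)
  set L₁ : ℝ → ℝ → ℝ := fun t x => ∑ k ∈ range (ℓ / 2 + 1), α k * T (2 * k) t x with hL₁
  set L₂ : ℝ → ℝ → ℝ := fun t x => ∑ k ∈ range ((ℓ + 1) / 2), β k * T (2 * k + 1) t x with hL₂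
  have hL₁C : ContDiff ℝ 2 (Function.uncurry L₁) := contDiff_two_lincomb _ α hB₁
  have hL₂C : ContDiff ℝ 2 (Function.uncurry L₂) := contDiff_two_lincomb _ β hB₂
  have hQL : Q = fun t x => L₁ t x + L₂ t x := hQf
  refine ⟨?_, ?_, ?_, ?_, ?_⟩
  -- regularity
  · rw [hQL]; exact hL₁C.add hL₂C
  -- residual
  · intro t x hx
    rw [hQL]
    have s1 := contDiff_two_slices'' hL₁C t x
    have s2 := contDiff_two_slices'' hL₂C t x
    show iteratedDeriv 2 (fun τ => L₁ τ x + L₂ τ x) t - iteratedDeriv 2 (fun y => L₁ t y + L₂ t y) x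
      + V x * (L₁ t x + L₂ t x) = 0
    rw [iteratedDeriv_fun_add (n := 2) s1.1.contDiffAt s2.1.contDiffAt,
      iteratedDeriv_fun_add (n := 2) s1.2.contDiffAt s2.2.contDiffAt]
    have r1 := wave1D_residual_lincomb (range (ℓ / 2 + 1)) α V hB₁ t x
    have r2 := wave1D_residual_lincomb (range ((ℓ + 1) / 2)) β V hB₂ t x
    have z1 : ∑ m ∈ range (ℓ / 2 + 1), α m * (iteratedDeriv 2 (fun τ => T (2 * m) τ x) t
        - iteratedDeriv 2 (T (2 * m) t) x + V x * T (2 * m) t x) = 0 :=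
      Finset.sum_eq_zero fun m hm => by rw [hTwave _ (hka m hm) t x hx, mul_zero]
    have z2 : ∑ m ∈ range ((ℓ + 1) / 2), β m * (iteratedDeriv 2 (fun τ => T (2 * m + 1) τ x) t
        - iteratedDeriv 2 (T (2 * m + 1) t) x + V x * T (2 * m + 1) t x) = 0 :=
      Finset.sum_eq_zero fun m hm => by rw [hTwave _ (hkb m hm) t x hx, mul_zero]
    simp only [hL₁, hL₂]
    have e1 : iteratedDeriv 2 (fun τ => ∑ k ∈ range (ℓ / 2 + 1), α k * T (2 * k) τ x) t
        - iteratedDeriv 2 (fun y => ∑ k ∈ range (ℓ / 2 + 1), α k * T (2 * k) t y) x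
        + V x * ∑ k ∈ range (ℓ / 2 + 1), α k * T (2 * k) t x = 0 := by rw [r1, z1]
    have e2 : iteratedDeriv 2 (fun τ => ∑ k ∈ range ((ℓ + 1) / 2), β k * T (2 * k + 1) τ x) t
        - iteratedDeriv 2 (fun y => ∑ k ∈ range ((ℓ + 1) / 2), β k * T (2 * k + 1) t y) x
        + V x * ∑ k ∈ range ((ℓ + 1) / 2), β k * T (2 * k + 1) t x = 0 := by rw [r2, z2]
    linarith
  -- `t`-polynomial form
  · refine ⟨fun i x => ∑ k ∈ range (ℓ / 2 + 1), α k * (((2 * k).choose i : ℝ) * E (2 * k - i) x)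
      + ∑ k ∈ range ((ℓ + 1) / 2), β k * (((2 * k + 1).choose i : ℝ) * E (2 * k + 1 - i) x), ?_⟩
    intro t x
    -- towers as polynomials of degree `≤ ℓ`
    have hText : ∀ m, m ≤ ℓ → T m t x = ∑ i ∈ range (ℓ + 1), (m.choose i : ℝ) * E (m - i) x * t ^ i := by
      intro m hm
      rw [hT]
      refine Finset.sum_subset (range_subset_range.2 (by omega)) fun i hi hni => ?_
      have : m < i := by
        have h1 := mem_range.1 hi
        have h2 : ¬ i < m + 1 := fun h => hni (mem_range.2 h)
        omega
      rw [Nat.choose_eq_zero_of_lt this]; simp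
    rw [hQ']
    beta_reduce
    simp only [add_mul, Finset.sum_add_distrib]
    congr 1
    · rw [Finset.sum_congr rfl fun k hk => by rw [hText _ (hka k hk)]]
      simp only [Finset.mul_sum, Finset.sum_mul]
      rw [Finset.sum_comm]
      exact Finset.sum_congr rfl fun i _ => Finset.sum_congr rfl fun k _ => by ring
    · rw [Finset.sum_congr rfl fun k hk => by rw [hText _ (hkb k hk)]]
      simp only [Finset.mul_sum, Finset.sum_mul]
      rw [Finset.sum_comm]
      exact Finset.sum_congr rfl fun i _ => Finset.sum_congr rfl fun k _ => by ring
  -- position datum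
  · intro y
    rw [hQ']
    refine congrArg₂ (· + ·) (Finset.sum_congr rfl fun k hk => ?_) (Finset.sum_congr rfl fun k hk => ?_)
    · rw [(hTdata _ (hka k hk) y).1]
    · rw [(hTdata _ (hkb k hk) y).1]
  -- velocity datum
  · intro z
    have hd : ∀ m, m ≤ ℓ → HasDerivAt (fun τ => T m τ z) ((m : ℝ) * E (m - 1) z) 0 := by
      intro m hm
      rw [← (hTdata m hm z).2]
      exact (((contDiff_two_slices'' (hTC m hm) 0 z).1.differentiable (by norm_num)) 0).hasDerivAt
    have h1 := HasDerivAt.fun_sum (u := range (ℓ / 2 + 1)) (A := fun k τ => α k * T (2 * k) τ z)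
      (A' := fun k => α k * (((2 * k : ℕ) : ℝ) * E (2 * k - 1) z)) (x := 0)
      fun k hk => (hd _ (hka k hk)).const_mul (α k)
    have h2 := HasDerivAt.fun_sum (u := range ((ℓ + 1) / 2)) (A := fun k τ => β k * T (2 * k + 1) τ z)
      (A' := fun k => β k * (((2 * k + 1 : ℕ) : ℝ) * E (2 * k) z)) (x := 0)
      fun k hk => by
        have := (hd _ (hkb k hk)).const_mul (β k)
        simpa only [Nat.add_sub_cancel] using this
    rw [hQL]
    show deriv (fun τ => L₁ τ z + L₂ τ z) 0 = _
    have hD : deriv (fun τ => L₁ τ z + L₂ τ z) 0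
        = ∑ k ∈ range (ℓ / 2 + 1), α k * (((2 * k : ℕ) : ℝ) * E (2 * k - 1) z)
          + ∑ k ∈ range ((ℓ + 1) / 2), β k * (((2 * k + 1 : ℕ) : ℝ) * E (2 * k) z) :=
      (h1.add h2).deriv
    rw [hD]
    refine congrArg₂ (· + ·) (Finset.sum_congr rfl fun k _ => ?_) rfl
    simp only [hα]; ring

end Literature.Analysis.PDE
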